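/-
Copyright: cell `pub-balaban-gaps` (G2), seat ne6 (row NE7b), `prover-pub-balaban-gaps-ne6-g16-0`. Project licence.
-/
import Summits.QuantumFields.BalabanUV.T4Continuum.Spine.NE7b.CompactFibreWindowSUNRate
import Mathlib.MeasureTheory.Integral.Layercake
import Mathlib.MeasureTheory.Integral.Pi

/-!
# THE HALVED-ACTION (LCS) LETTER OF THE COMPACT `SU(N)` FIBRE IS COUPLING-FREE AT PRINT's RATE `½·d(𝔤)`:
# window DOUBLING `Haar{‖V − 1‖ ≤ λη} ≤ D·λ^{N²−1}·Haar{‖V − 1‖ ≤ η}`, hence by layer cake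
# `∫ e^{δβ·Re tr(1−V)}·e^{−β·Re tr(1−V)} dHaar ≤ D·(√(1−δ))^{−(N²−1)}·∫ e^{−β·Re tr(1−V)} dHaar` for ALL `β ≥ 0`, `0 ≤ δ < 1`
# (row NE7b, node U5c; MODEL, [folklore]; census V38 of the cell `pub-balaban-gaps`)

Cell `pub-balaban-gaps` (G2 spine census) for the `pub-balaban` T⁴ crux NE7b (`T4WeightBudget.RelWeightBound`; NOT PRINTED, NOT PROVED).
Crux-route work under `Spine/NE7b/`; imports the census file V29 `CompactFibreWindowSUNRate` (the two-sided small-ball law of `SU(N)` at the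
exponent `N² − 1`, from the tree's [VaropoulosSaloffcosteCoulhon1993] Thm. V.4.1) and Mathlib's layer-cake formula; no `def`, zero `sorry`, no
`Prop` of Bałaban's minted, nothing of Bałaban's asserted.

THE LOCATED QUESTION (census V38).  The row's first missing lemma of Bałaban's kind is an inhabitant of `LocalConditionalStability.LocCondStability`:
the conditional expectation of the SACRIFICED part `e^{δ·(action on Z)}` of a term's own action is `≤ e^{b}` in the term's own state, with `b = O(1)·|Z|`
UNIFORMLY IN THE RUNNING COUPLING ([Balaban1989LargeFieldI] (0.3)–(0.5) «determined by small field effective actions only»; Dimock III (184): for a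
halved Gaussian the price is the coupling-free factor `2^{n∕2}`; in kernel `LocalConditionalStability.gaussian_partial_moment`: `(√(1−δ))⁻¹` per real
Gaussian variable).  QUESTION: in the (n)-carrier's REFERENCE STATE of the compact-fibre model (product Haar on `bonds → SU(N)`, V19–V36) with the Wilson
one-plaquette weights `e^{−β·Re tr(1−V)}`, is the halved-action letter coupling-free, and at what rate in the sacrificed fraction `δ`?

ANSWER (this file, [folklore]): YES, at print's rate `½·d(𝔤) = (N² − 1)∕2` — the SAME rate as the window-volume letter of V29:
* §1 `re_trace_one_sub_le_two_mul` (`Re tr(1 − V) ≤ 2N` on `SU(N)`; `≥ 0` is V35's `re_trace_one_sub_nonneg`, inlined), `sball_eq_univ_of_le` (the Hilbert–Schmidt ball of radius `≥ 2√N` is everything).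
* §2 **`exists_haarReal_sball_doubling`**: `∃ D ≥ 1, ∀ λ ≥ 1, ∀ η ≥ 0, Haar_{SU(N)}{‖V − 1‖_HS ≤ λη} ≤ D·λ^{N²−1}·Haar_{SU(N)}{‖V − 1‖_HS ≤ η}` — the
  window-volume function is DOUBLING with the exponent `dim SU(N)`, at ALL radii (V29's two-sided law below the diameter, saturation above it);
  **`exists_haarReal_traceWindow_doubling`**: the same for the trace windows `{Re tr(1 − V) ≤ λ²t}` vs `{Re tr(1 − V) ≤ t}`, all real `t`.
* §3 `integral_exp_neg_mul_le_of_sublevel` (generic layer cake: on a finite measure space, if every sublevel mass of `a·s` is `≤ K·` that of `b·s`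
  (`s ≥ 0`, `b ≥ 0`) then `∫ e^{−a·s} ≤ K·∫ e^{−b·s}`); **`exists_halvedAction_moment_le`**: ONE `D ≥ 1` with
  `∫ e^{δβ·Re tr(1−V)}·e^{−β·Re tr(1−V)} dHaar ≤ D·((√(1−δ))⁻¹)^{N²−1}·∫ e^{−β·Re tr(1−V)} dHaar` for ALL `β ≥ 0` and ALL `0 ≤ δ < 1` — the `SU(N)`
  one-plaquette form of `gaussian_partial_moment`, COUPLING-FREE, blowing up only like `(1−δ)^{−dim SU(N)∕2}` as `δ → 1`.
* §4 the REGION: **`pi_halvedAction_moment_le`** (product Haar on `B → SU(N)`, summed deficits `S = Σ_b Re tr(1 − V_b)`: the one-plaquette bound with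
  constant `K` gives `∫ e^{δβS}·e^{−βS} ≤ K^{#B}·∫ e^{−βS}`) and the LETTER **`exists_lcsLetter_compactFibre`**:
  `∫ e^{δβS}·e^{−βS} dκ ≤ exp(#B·(c + ((N² − 1)∕2)·log(1−δ)⁻¹))·∫ e^{−βS} dκ`, one `c ≥ 0` for all `B`, `β ≥ 0`, `0 ≤ δ < 1` — the `LocCondStability`
  exponent `b = |Z|·(½·d(𝔤)·log(1−δ)⁻¹ + c)` of the reference state, β-FREE.
* §5 Sanity (`N = 2`: exponent `3`, factor `(√(1−δ))⁻³ = (1−δ)^{−3∕2}` — V26's rate `3∕2`).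

HONEST REMARKS.  (i) MODEL ∕ [folklore]: the reference state is the PRODUCT Haar of the compact-fibre carrier, not the interacting Wilson measure of a
torus — for THAT (d = 4, odd tori, `β ≥ 4`, tilt `a ≤ ½`, every compact `G`) the tree already PROVES the local exponential plaquette moment bound
`E_β[e^{aβΣ_{p∈Q}A_p}] ≤ e^{C·a·|Q|}` (`LocalPlaquetteExpMoments.localExpMoment_class ∕ …All.localExpMoment`, seat t4-ne7b-formalise-leaf-06; chessboard +
convexity + uniform torus doubling) — not imported here, cited by name; what this file adds is the SHARP `δ → 1` law of the letter at print's rate and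
all `β ≥ 0`, in the fibre.  (ii) The constant `D = C²` is V29's SOFT two-sided constant squared (existential; the explicit halves V33∕V36 would value it —
their oleans are not yet built on the check farm, so they are not imported).  (iii) The one-plaquette RATE itself (`∫ e^{−β·Re tr(1−V)} dHaar ≍ β^{−(N²−1)∕2}`,
`β ≥ 1`) is not needed for the letter and is NOT proved here.  (iv) Which `δ`, which region `Z` and that Bałaban's creation-level carrier IS the compact-fibre
one are (A3) ∕ (A1c) readings — NOT asserted; NC-NE7b-α UNRULED.  BY-NAME EFFECT ON THE WALL: NONE.  NE7b NOT PRINTED ∕ NOT PROVED; spine PROVED 0∕9;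
rung (B)+1 on ONE finite T⁴ — NOT infinite volume, NOT the mass gap, NOT Clay.
HONEST DEPENDENCY: continuum YM on T⁴ ⇐ BetaPertH ∧ nine spine estimates (0/9 proved); BetaPertH ⇐ (D1) ∧ (D4) ∧ CAP+tail;
G-an2-4 gates asym, D1 and NE2/3/4.  This file changes none of it.
-/

set_option autoImplicit false

noncomputable section

open MeasureTheory Real Finset Set
open scoped Matrix.Norms.Frobenius ENNReal
open Literature.MathematicalPhysics.QuantumFieldTheory (haarProbability)
open Literature.MathematicalPhysics.QuantumFieldTheory.UnitaryCayley (re_trace_one_sub)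
open Summit.QuantumFields.BalabanUV.T4Continuum.NE7b.CompactFibreWindowSUN (measurableSet_sball sball_eq_traceWindow)
open Summit.QuantumFields.BalabanUV.T4Continuum.NE7b.CompactFibreWindowSUNRate (exists_haarReal_sball_two_sided traceWindow_eq_sball)

namespace Summit.QuantumFields.BalabanUV.T4Continuum.NE7b.CompactFibreHalvedActionSUN

variable {N : ℕ}

/-! ## §1 The trace deficit `Re tr(1 − V)` on `SU(N)`: `≤ 2N`, measurability, and the ball of radius `2√N` is everything -/

section Deficit

/-- `Re tr(1 − V) ≤ 2N` on `SU(N)` (every entry of a unitary matrix has norm `≤ 1`). [folklore] -/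
theorem re_trace_one_sub_le_two_mul (V : Matrix.specialUnitaryGroup (Fin N) ℂ) : (Matrix.trace (1 - (V : Matrix (Fin N) (Fin N) ℂ))).re ≤ 2 * (N : ℝ) := by
  have hU : (V : Matrix (Fin N) (Fin N) ℂ) ∈ Matrix.unitaryGroup (Fin N) ℂ := (Matrix.mem_specialUnitaryGroup_iff.1 V.2).1
  have htr : -(N : ℝ) ≤ (Matrix.trace (V : Matrix (Fin N) (Fin N) ℂ)).re := by
    rw [Matrix.trace, Complex.re_sum]
    calc -(N : ℝ) = ∑ _i : Fin N, (-1 : ℝ) := by simp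
      _ ≤ ∑ i, ((V : Matrix (Fin N) (Fin N) ℂ).diag i).re := Finset.sum_le_sum fun i _ => by
          have h1 := entry_norm_bound_of_unitary hU i i
          have h2 := Complex.abs_re_le_norm ((V : Matrix (Fin N) (Fin N) ℂ) i i)
          rw [Matrix.diag_apply]
          linarith [(abs_le.1 (h2.trans h1)).1]
  rw [Matrix.trace_sub, Matrix.trace_one, Complex.sub_re, Fintype.card_fin, Complex.natCast_re]
  linarith

/-- `V ↦ Re tr(1 − V)` is measurable on `SU(N)` (it is continuous). [folklore] -/
theorem measurable_re_trace_one_sub : Measurable fun V : Matrix.specialUnitaryGroup (Fin N) ℂ => (Matrix.trace (1 - (V : Matrix (Fin N) (Fin N) ℂ))).re :=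
  (Complex.continuous_re.comp ((continuous_const.sub continuous_subtype_val).matrix_trace)).measurable

/-- The trace window `{Re tr(1 − V) ≤ t}` is measurable. [folklore] -/
theorem measurableSet_traceWindow (t : ℝ) : MeasurableSet {V : Matrix.specialUnitaryGroup (Fin N) ℂ | (Matrix.trace (1 - (V : Matrix (Fin N) (Fin N) ℂ))).re ≤ t} :=
  measurableSet_le measurable_re_trace_one_sub measurable_const

/-- **SATURATION**: the Hilbert–Schmidt ball of radius `η ≥ 2√N` about `1` is all of `SU(N)` (`‖1 − V‖² = 2·Re tr(1 − V) ≤ 4N`). [folklore] -/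
theorem sball_eq_univ_of_le {η : ℝ} (hη : 2 * Real.sqrt N ≤ η) : {V : Matrix.specialUnitaryGroup (Fin N) ℂ | ‖(V : Matrix (Fin N) (Fin N) ℂ) - 1‖ ≤ η} = Set.univ := by
  refine Set.eq_univ_of_forall fun V => ?_
  have hU : (V : Matrix (Fin N) (Fin N) ℂ) ∈ Matrix.unitaryGroup (Fin N) ℂ := (Matrix.mem_specialUnitaryGroup_iff.1 V.2).1
  have h1 := re_trace_one_sub hU
  have h2 := re_trace_one_sub_le_two_mul V
  have hsq : ‖(1 : Matrix (Fin N) (Fin N) ℂ) - (V : Matrix (Fin N) (Fin N) ℂ)‖ ^ 2 ≤ (2 * Real.sqrt N) ^ 2 := by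
    rw [mul_pow, Real.sq_sqrt (Nat.cast_nonneg N)]; linarith
  have h3 : ‖(1 : Matrix (Fin N) (Fin N) ℂ) - (V : Matrix (Fin N) (Fin N) ℂ)‖ ≤ 2 * Real.sqrt N :=
    (pow_le_pow_iff_left₀ (norm_nonneg _) (by positivity) two_ne_zero).1 hsq
  rw [Set.mem_setOf_eq, norm_sub_rev]
  exact h3.trans hη

/-- For `t < 0` the trace window is empty. [folklore] -/
theorem traceWindow_eq_empty_of_neg {t : ℝ} (ht : t < 0) : {V : Matrix.specialUnitaryGroup (Fin N) ℂ | (Matrix.trace (1 - (V : Matrix (Fin N) (Fin N) ℂ))).re ≤ t} = ∅ :=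
  Set.eq_empty_of_forall_notMem fun V hV => by
    -- `Re tr(1 − V) = ½‖1 − V‖² ≥ 0` (the tree's Lemma 7.2; as a named lemma this is `CompactFibreProfileVolumeSUN.re_trace_one_sub_nonneg`)
    have h0 : 0 ≤ (Matrix.trace (1 - (V : Matrix (Fin N) (Fin N) ℂ))).re := by rw [re_trace_one_sub (Matrix.mem_specialUnitaryGroup_iff.1 V.2).1]; positivity
    rw [Set.mem_setOf_eq] at hV; linarith

end Deficit

/-! ## §2 DOUBLING of the window-volume function of `SU(N)`, exponent `N² − 1 = dim SU(N)`, at all radii -/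

section Doubling

/-- **WINDOW DOUBLING ON `SU(N)`**: there is `D ≥ 1` with `Haar_{SU(N)}{‖V − 1‖_HS ≤ λη} ≤ D·λ^{N²−1}·Haar_{SU(N)}{‖V − 1‖_HS ≤ η}` for ALL `λ ≥ 1` and ALL
`η ≥ 0` (`D = C²` for V29's two-sided constant `C` on the radii `≤ max(2√N, 1)`; above that radius the ball is everything). [folklore] -/
theorem exists_haarReal_sball_doubling : ∃ D : ℝ, 1 ≤ D ∧ ∀ l : ℝ, 1 ≤ l → ∀ η : ℝ, 0 ≤ η →
    (haarProbability (Matrix.specialUnitaryGroup (Fin N) ℂ)).real {V : Matrix.specialUnitaryGroup (Fin N) ℂ | ‖(V : Matrix (Fin N) (Fin N) ℂ) - 1‖ ≤ l * η}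
      ≤ D * l ^ (N ^ 2 - 1) * (haarProbability (Matrix.specialUnitaryGroup (Fin N) ℂ)).real {V : Matrix.specialUnitaryGroup (Fin N) ℂ | ‖(V : Matrix (Fin N) (Fin N) ℂ) - 1‖ ≤ η} := by
  set R : ℝ := max (2 * Real.sqrt N) 1 with hR
  have hR0 : 0 < R := lt_of_lt_of_le one_pos (le_max_right _ _)
  have hR1 : 1 ≤ R := le_max_right _ _
  obtain ⟨C, hC, hlaw⟩ := exists_haarReal_sball_two_sided (N := N) hR0
  set μ := haarProbability (Matrix.specialUnitaryGroup (Fin N) ℂ) with hμ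
  set d : ℕ := N ^ 2 - 1 with hd
  have hC0 : 0 < C := by linarith
  refine ⟨C ^ 2, by nlinarith, fun l hl η hη => ?_⟩
  have hl0 : 0 < l := by linarith
  have hld : 1 ≤ l ^ d := one_le_pow₀ hl
  have hm0 : 0 ≤ μ.real {V : Matrix.specialUnitaryGroup (Fin N) ℂ | ‖(V : Matrix (Fin N) (Fin N) ℂ) - 1‖ ≤ η} := measureReal_nonneg
  have hm1 : μ.real {V : Matrix.specialUnitaryGroup (Fin N) ℂ | ‖(V : Matrix (Fin N) (Fin N) ℂ) - 1‖ ≤ l * η} ≤ 1 := measureReal_le_one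
  rcases hη.eq_or_lt with hη0 | hηpos
  · -- η = 0: both windows coincide; the factor is ≥ 1
    subst hη0
    rw [mul_zero]
    have h1 : (1 : ℝ) ≤ C ^ 2 * l ^ d := by nlinarith
    calc μ.real {V : Matrix.specialUnitaryGroup (Fin N) ℂ | ‖(V : Matrix (Fin N) (Fin N) ℂ) - 1‖ ≤ 0}
        = 1 * μ.real {V : Matrix.specialUnitaryGroup (Fin N) ℂ | ‖(V : Matrix (Fin N) (Fin N) ℂ) - 1‖ ≤ 0} := (one_mul _).symm
      _ ≤ C ^ 2 * l ^ d * μ.real {V : Matrix.specialUnitaryGroup (Fin N) ℂ | ‖(V : Matrix (Fin N) (Fin N) ℂ) - 1‖ ≤ 0} :=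
          mul_le_mul_of_nonneg_right h1 measureReal_nonneg
  by_cases hcase : l * η ≤ R
  · -- below the saturation radius: two-sided law at both radii
    have hηR : η ≤ R := le_trans (by nlinarith) hcase
    obtain ⟨hlowη, -⟩ := hlaw η hηpos hηR
    obtain ⟨-, huplη⟩ := hlaw (l * η) (by positivity) hcase
    have hpow : η ^ d ≤ C * μ.real {V : Matrix.specialUnitaryGroup (Fin N) ℂ | ‖(V : Matrix (Fin N) (Fin N) ℂ) - 1‖ ≤ η} := by
      have := mul_le_mul_of_nonneg_left hlowη hC0.le
      rwa [← mul_assoc, mul_inv_cancel₀ hC0.ne', one_mul] at this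
    calc μ.real {V : Matrix.specialUnitaryGroup (Fin N) ℂ | ‖(V : Matrix (Fin N) (Fin N) ℂ) - 1‖ ≤ l * η}
        ≤ C * (l * η) ^ d := huplη
      _ = C * l ^ d * η ^ d := by rw [mul_pow]; ring
      _ ≤ C * l ^ d * (C * μ.real {V : Matrix.specialUnitaryGroup (Fin N) ℂ | ‖(V : Matrix (Fin N) (Fin N) ℂ) - 1‖ ≤ η}) :=
          mul_le_mul_of_nonneg_left hpow (by positivity)
      _ = C ^ 2 * l ^ d * μ.real {V : Matrix.specialUnitaryGroup (Fin N) ℂ | ‖(V : Matrix (Fin N) (Fin N) ℂ) - 1‖ ≤ η} := by ring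
  · -- above the saturation radius the left window has mass ≤ 1; the right side is ≥ 1
    push Not at hcase
    by_cases hηR : η ≤ R
    · obtain ⟨hlowη, -⟩ := hlaw η hηpos hηR
      have hRd : 1 ≤ R ^ d := one_le_pow₀ hR1
      have hle : R ^ d ≤ (l * η) ^ d := pow_le_pow_left₀ hR0.le hcase.le d
      have h1 : 1 ≤ C ^ 2 * l ^ d * μ.real {V : Matrix.specialUnitaryGroup (Fin N) ℂ | ‖(V : Matrix (Fin N) (Fin N) ℂ) - 1‖ ≤ η} :=
        calc (1 : ℝ) ≤ C * R ^ d := by nlinarith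
          _ ≤ C * (l * η) ^ d := mul_le_mul_of_nonneg_left hle hC0.le
          _ = C ^ 2 * l ^ d * (C⁻¹ * η ^ d) := by rw [mul_pow]; field_simp
          _ ≤ C ^ 2 * l ^ d * μ.real {V : Matrix.specialUnitaryGroup (Fin N) ℂ | ‖(V : Matrix (Fin N) (Fin N) ℂ) - 1‖ ≤ η} :=
              mul_le_mul_of_nonneg_left hlowη (by positivity)
      exact hm1.trans h1
    · push Not at hηR
      have huniv : {V : Matrix.specialUnitaryGroup (Fin N) ℂ | ‖(V : Matrix (Fin N) (Fin N) ℂ) - 1‖ ≤ η} = Set.univ :=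
        sball_eq_univ_of_le (le_trans (le_max_left _ _) hηR.le)
      rw [huniv, probReal_univ, mul_one]
      exact hm1.trans (by nlinarith)

/-- **TRACE-WINDOW DOUBLING**: with the same kind of constant, `Haar{Re tr(1 − V) ≤ λ²·t} ≤ D·λ^{N²−1}·Haar{Re tr(1 − V) ≤ t}` for ALL `λ ≥ 1` and ALL real `t`
(`t < 0`: both windows are empty; `t ≥ 0`: the trace window is the Hilbert–Schmidt ball of radius `√(2t)`, and `√(2λ²t) = λ√(2t)`). [folklore] -/
theorem exists_haarReal_traceWindow_doubling : ∃ D : ℝ, 1 ≤ D ∧ ∀ l : ℝ, 1 ≤ l → ∀ t : ℝ,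
    (haarProbability (Matrix.specialUnitaryGroup (Fin N) ℂ)).real {V : Matrix.specialUnitaryGroup (Fin N) ℂ | (Matrix.trace (1 - (V : Matrix (Fin N) (Fin N) ℂ))).re ≤ l ^ 2 * t}
      ≤ D * l ^ (N ^ 2 - 1) * (haarProbability (Matrix.specialUnitaryGroup (Fin N) ℂ)).real {V : Matrix.specialUnitaryGroup (Fin N) ℂ | (Matrix.trace (1 - (V : Matrix (Fin N) (Fin N) ℂ))).re ≤ t} := by
  obtain ⟨D, hD, h⟩ := exists_haarReal_sball_doubling (N := N)
  refine ⟨D, hD, fun l hl t => ?_⟩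
  have hl0 : 0 ≤ l := by linarith
  rcases lt_or_ge t 0 with ht | ht
  · have ht' : l ^ 2 * t ≤ 0 := mul_nonpos_of_nonneg_of_nonpos (sq_nonneg l) ht.le
    rcases ht'.eq_or_lt with h0 | hneg
    · -- degenerate `l²t = 0` cannot happen for `t < 0`, `l ≥ 1`; handled uniformly anyway
      have : l ^ 2 * t < 0 := mul_neg_of_pos_of_neg (by positivity) ht
      linarith
    · rw [traceWindow_eq_empty_of_neg hneg, traceWindow_eq_empty_of_neg ht, measureReal_empty, mul_zero]
  · rw [traceWindow_eq_sball (by positivity : 0 ≤ l ^ 2 * t), traceWindow_eq_sball ht]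
    have hsq : Real.sqrt (2 * (l ^ 2 * t)) = l * Real.sqrt (2 * t) := by
      rw [show 2 * (l ^ 2 * t) = l ^ 2 * (2 * t) by ring, Real.sqrt_mul (sq_nonneg l), Real.sqrt_sq hl0]
    rw [hsq]
    exact h l hl _ (Real.sqrt_nonneg _)

end Doubling

/-! ## §3 Layer cake: sublevel domination ⟹ Boltzmann domination; the coupling-free halved-action moment on one plaquette variable -/

section LayerCake

variable {X : Type*} [MeasurableSpace X] (μ : Measure X) [IsFiniteMeasure μ]

/-- **GENERIC LAYER CAKE.**  On a finite measure space, `s ≥ 0` measurable, `b ≥ 0`, `K ≥ 0`, `a` real: if every sublevel mass of `a·s` is at most `K` times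
that of `b·s` (`μ{a·s ≤ L} ≤ K·μ{b·s ≤ L}` for all real `L`), then `∫ e^{−a·s} dμ ≤ K·∫ e^{−b·s} dμ` (Mathlib's `lintegral_eq_lintegral_meas_le`:
`∫ e^{−a·s} = ∫₀^∞ μ{t ≤ e^{−a·s}} dt` and `{t ≤ e^{−a·s}} = {a·s ≤ −log t}` for `t > 0`). [folklore] -/
theorem integral_exp_neg_mul_le_of_sublevel {s : X → ℝ} (hs : Measurable s) (hs0 : ∀ x, 0 ≤ s x) {a b K : ℝ} (hb : 0 ≤ b) (hK : 0 ≤ K)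
    (h : ∀ L : ℝ, μ.real {x | a * s x ≤ L} ≤ K * μ.real {x | b * s x ≤ L}) :
    ∫ x, Real.exp (-(a * s x)) ∂μ ≤ K * ∫ x, Real.exp (-(b * s x)) ∂μ := by
  -- both Boltzmann factors are measurable, in `[0, 1]`, hence integrable
  have hmeas : ∀ c : ℝ, Measurable fun x => Real.exp (-(c * s x)) := fun c => (Real.measurable_exp.comp ((hs.const_mul c).neg))
  have hle1 : ∀ c : ℝ, 0 ≤ c → ∀ x, Real.exp (-(c * s x)) ≤ 1 := fun c hc x => by
    rw [Real.exp_le_one_iff]; nlinarith [hs0 x]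
  have hint : ∀ c : ℝ, 0 ≤ c → Integrable (fun x => Real.exp (-(c * s x))) μ := fun c hc =>
    Integrable.of_bound (hmeas c).aestronglyMeasurable 1 (ae_of_all _ fun x => by
      rw [Real.norm_eq_abs, abs_of_pos (Real.exp_pos _)]; exact hle1 c hc x)
  -- the sublevel domination in `ℝ≥0∞`
  have hsub : ∀ L : ℝ, μ {x | a * s x ≤ L} ≤ ENNReal.ofReal K * μ {x | b * s x ≤ L} := fun L => by
    have h1 := h L
    rw [measureReal_def, measureReal_def] at h1
    calc μ {x | a * s x ≤ L} = ENNReal.ofReal ((μ {x | a * s x ≤ L}).toReal) := (ENNReal.ofReal_toReal (measure_ne_top _ _)).symm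
      _ ≤ ENNReal.ofReal (K * (μ {x | b * s x ≤ L}).toReal) := ENNReal.ofReal_le_ofReal h1
      _ = ENNReal.ofReal K * μ {x | b * s x ≤ L} := by rw [ENNReal.ofReal_mul hK, ENNReal.ofReal_toReal (measure_ne_top _ _)]
  -- layer cake on both sides
  have hcakeA := lintegral_eq_lintegral_meas_le μ (ae_of_all _ fun x => (Real.exp_pos (-(a * s x))).le) (hmeas a).aemeasurable
  have hcakeB := lintegral_eq_lintegral_meas_le μ (ae_of_all _ fun x => (Real.exp_pos (-(b * s x))).le) (hmeas b).aemeasurable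
  have hsets : ∀ c : ℝ, ∀ t : ℝ, 0 < t → {x | t ≤ Real.exp (-(c * s x))} = {x | c * s x ≤ -Real.log t} := fun c t ht => by
    ext x
    simp only [Set.mem_setOf_eq]
    rw [← Real.log_le_iff_le_exp ht]
    constructor <;> intro hx <;> linarith
  have hlin : ∫⁻ x, ENNReal.ofReal (Real.exp (-(a * s x))) ∂μ ≤ ENNReal.ofReal K * ∫⁻ x, ENNReal.ofReal (Real.exp (-(b * s x))) ∂μ := by
    rw [hcakeA, hcakeB, ← lintegral_const_mul' _ _ ENNReal.ofReal_ne_top]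
    refine setLIntegral_mono' measurableSet_Ioi fun t ht => ?_
    rw [hsets a t ht, hsets b t ht]
    exact hsub _
  -- back to real integrals
  have hfinB : ∫⁻ x, ENNReal.ofReal (Real.exp (-(b * s x))) ∂μ ≠ ∞ := (hint b hb).lintegral_lt_top.ne
  rw [integral_eq_lintegral_of_nonneg_ae (ae_of_all _ fun x => (Real.exp_pos _).le) (hmeas a).aestronglyMeasurable,
    integral_eq_lintegral_of_nonneg_ae (ae_of_all _ fun x => (Real.exp_pos _).le) (hmeas b).aestronglyMeasurable,
    ← ENNReal.toReal_ofReal hK, ← ENNReal.toReal_mul]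
  exact ENNReal.toReal_mono (ENNReal.mul_ne_top ENNReal.ofReal_ne_top hfinB) hlin

end LayerCake

section OnePlaquette

/-- **THE HALVED-ACTION MOMENT ON THE `SU(N)` FIBRE IS COUPLING-FREE AT RATE `½·d(𝔤)`.**  There is `D ≥ 1` (the doubling constant of §2) such that for
ALL `β ≥ 0` and ALL `0 ≤ δ < 1`:
`∫ e^{δβ·Re tr(1−V)}·e^{−β·Re tr(1−V)} dHaar_{SU(N)}(V) ≤ D·((√(1−δ))⁻¹)^{N²−1}·∫ e^{−β·Re tr(1−V)} dHaar_{SU(N)}(V)` — the `SU(N)` one-plaquette form of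
`LocalConditionalStability.gaussian_partial_moment` (`(√(1−δ))⁻¹` per real Gaussian variable ↦ `(√(1−δ))^{−dim SU(N)}` per plaquette variable, up to `D`). [folklore] -/
theorem exists_halvedAction_moment_le : ∃ D : ℝ, 1 ≤ D ∧ ∀ β δ : ℝ, 0 ≤ β → 0 ≤ δ → δ < 1 →
    ∫ V, Real.exp (δ * β * (Matrix.trace (1 - (V : Matrix (Fin N) (Fin N) ℂ))).re) * Real.exp (-(β * (Matrix.trace (1 - (V : Matrix (Fin N) (Fin N) ℂ))).re)) ∂(haarProbability (Matrix.specialUnitaryGroup (Fin N) ℂ))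
      ≤ D * (Real.sqrt (1 - δ))⁻¹ ^ (N ^ 2 - 1) * ∫ V, Real.exp (-(β * (Matrix.trace (1 - (V : Matrix (Fin N) (Fin N) ℂ))).re)) ∂(haarProbability (Matrix.specialUnitaryGroup (Fin N) ℂ)) := by
  obtain ⟨D, hD, hdoub⟩ := exists_haarReal_traceWindow_doubling (N := N)
  refine ⟨D, hD, fun β δ hβ hδ0 hδ1 => ?_⟩
  set μ := haarProbability (Matrix.specialUnitaryGroup (Fin N) ℂ) with hμ
  set d : ℕ := N ^ 2 - 1 with hd
  have h1δ : 0 < 1 - δ := by linarith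
  have hsqrt : 0 < Real.sqrt (1 - δ) := Real.sqrt_pos.2 h1δ
  set l : ℝ := (Real.sqrt (1 - δ))⁻¹ with hl
  have hl1 : 1 ≤ l := by
    rw [hl, one_le_inv₀ hsqrt]
    have : Real.sqrt (1 - δ) ≤ Real.sqrt 1 := Real.sqrt_le_sqrt (by linarith)
    rwa [Real.sqrt_one] at this
  have hl2 : l ^ 2 = (1 - δ)⁻¹ := by rw [hl, inv_pow, Real.sq_sqrt h1δ.le]
  -- rewrite the tilted Boltzmann factor as the Boltzmann factor at the smaller coupling `(1−δ)β`
  have hrew : ∀ V : Matrix.specialUnitaryGroup (Fin N) ℂ,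
      Real.exp (δ * β * (Matrix.trace (1 - (V : Matrix (Fin N) (Fin N) ℂ))).re) * Real.exp (-(β * (Matrix.trace (1 - (V : Matrix (Fin N) (Fin N) ℂ))).re))
        = Real.exp (-((1 - δ) * β * (Matrix.trace (1 - (V : Matrix (Fin N) (Fin N) ℂ))).re)) := fun V => by
    rw [← Real.exp_add]; ring_nf
  simp_rw [hrew]
  -- sublevel domination from trace-window doubling
  have hsub : ∀ L : ℝ, μ.real {V : Matrix.specialUnitaryGroup (Fin N) ℂ | (1 - δ) * β * (Matrix.trace (1 - (V : Matrix (Fin N) (Fin N) ℂ))).re ≤ L}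
      ≤ D * l ^ d * μ.real {V : Matrix.specialUnitaryGroup (Fin N) ℂ | β * (Matrix.trace (1 - (V : Matrix (Fin N) (Fin N) ℂ))).re ≤ L} := by
    intro L
    rcases hβ.eq_or_lt with hβ0 | hβpos
    · -- β = 0: both windows are `{0 ≤ L}`, the factor is ≥ 1
      subst hβ0
      simp only [mul_zero, zero_mul]
      have h1 : (1 : ℝ) ≤ D * l ^ d := by nlinarith [one_le_pow₀ (n := d) hl1]
      calc μ.real {V : Matrix.specialUnitaryGroup (Fin N) ℂ | (0 : ℝ) ≤ L} = 1 * μ.real {V : Matrix.specialUnitaryGroup (Fin N) ℂ | (0 : ℝ) ≤ L} := (one_mul _).symm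
        _ ≤ D * l ^ d * μ.real {V : Matrix.specialUnitaryGroup (Fin N) ℂ | (0 : ℝ) ≤ L} := mul_le_mul_of_nonneg_right h1 measureReal_nonneg
    · have hβ' : 0 < (1 - δ) * β := mul_pos h1δ hβpos
      have hA : {V : Matrix.specialUnitaryGroup (Fin N) ℂ | (1 - δ) * β * (Matrix.trace (1 - (V : Matrix (Fin N) (Fin N) ℂ))).re ≤ L}
          = {V : Matrix.specialUnitaryGroup (Fin N) ℂ | (Matrix.trace (1 - (V : Matrix (Fin N) (Fin N) ℂ))).re ≤ l ^ 2 * (L / β)} := by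
        ext V; simp only [Set.mem_setOf_eq]
        rw [hl2, show (1 - δ)⁻¹ * (L / β) = L / ((1 - δ) * β) by field_simp, le_div_iff₀ hβ']
        constructor <;> intro h <;> linarith
      have hB : {V : Matrix.specialUnitaryGroup (Fin N) ℂ | β * (Matrix.trace (1 - (V : Matrix (Fin N) (Fin N) ℂ))).re ≤ L}
          = {V : Matrix.specialUnitaryGroup (Fin N) ℂ | (Matrix.trace (1 - (V : Matrix (Fin N) (Fin N) ℂ))).re ≤ L / β} := by
        ext V; simp only [Set.mem_setOf_eq]
        rw [le_div_iff₀ hβpos]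
        constructor <;> intro h <;> linarith
      rw [hA, hB]
      exact hdoub l hl1 (L / β)
  have hK : 0 ≤ D * l ^ d := by have := one_le_pow₀ (n := d) hl1; nlinarith
  have := integral_exp_neg_mul_le_of_sublevel μ measurable_re_trace_one_sub
    (fun V => by rw [re_trace_one_sub (Matrix.mem_specialUnitaryGroup_iff.1 V.2).1]; positivity) hβ hK hsub
  simpa only [mul_assoc] using this

end OnePlaquette

/-! ## §4 The REGION: product Haar on `B → SU(N)`, the letter `b = #B·(½·(N² − 1)·log(1−δ)⁻¹ + c)`, β-free -/

section Region

variable {B : Type*} [Fintype B]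

/-- **PRODUCT FORM.**  If the one-plaquette tilted moment is bounded by `K·` the untilted one (at the given `β, δ`), then on the product Haar of `B → SU(N)` with
the summed deficit `S(v) = Σ_b Re tr(1 − v_b)`: `∫ e^{δβS}·e^{−βS} ≤ K^{#B}·∫ e^{−βS}` (both sides factor over the bonds, Mathlib `integral_fintype_prod_eq_pow`). [folklore] -/
theorem pi_halvedAction_moment_le {β δ K : ℝ}
    (hone : ∫ V, Real.exp (δ * β * (Matrix.trace (1 - (V : Matrix (Fin N) (Fin N) ℂ))).re) * Real.exp (-(β * (Matrix.trace (1 - (V : Matrix (Fin N) (Fin N) ℂ))).re)) ∂(haarProbability (Matrix.specialUnitaryGroup (Fin N) ℂ))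
      ≤ K * ∫ V, Real.exp (-(β * (Matrix.trace (1 - (V : Matrix (Fin N) (Fin N) ℂ))).re)) ∂(haarProbability (Matrix.specialUnitaryGroup (Fin N) ℂ))) :
    ∫ v, Real.exp (δ * β * ∑ b, (Matrix.trace (1 - ((v b : Matrix.specialUnitaryGroup (Fin N) ℂ) : Matrix (Fin N) (Fin N) ℂ))).re)
        * Real.exp (-(β * ∑ b, (Matrix.trace (1 - ((v b : Matrix.specialUnitaryGroup (Fin N) ℂ) : Matrix (Fin N) (Fin N) ℂ))).re)) ∂(Measure.pi fun _ : B => haarProbability (Matrix.specialUnitaryGroup (Fin N) ℂ))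
      ≤ K ^ Fintype.card B * ∫ v, Real.exp (-(β * ∑ b, (Matrix.trace (1 - ((v b : Matrix.specialUnitaryGroup (Fin N) ℂ) : Matrix (Fin N) (Fin N) ℂ))).re)) ∂(Measure.pi fun _ : B => haarProbability (Matrix.specialUnitaryGroup (Fin N) ℂ)) := by
  set μ := haarProbability (Matrix.specialUnitaryGroup (Fin N) ℂ) with hμ
  -- factor both integrands over the bonds
  have hL : ∀ v : B → Matrix.specialUnitaryGroup (Fin N) ℂ,
      Real.exp (δ * β * ∑ b, (Matrix.trace (1 - ((v b : Matrix.specialUnitaryGroup (Fin N) ℂ) : Matrix (Fin N) (Fin N) ℂ))).re)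
        * Real.exp (-(β * ∑ b, (Matrix.trace (1 - ((v b : Matrix.specialUnitaryGroup (Fin N) ℂ) : Matrix (Fin N) (Fin N) ℂ))).re))
        = ∏ b, (Real.exp (δ * β * (Matrix.trace (1 - ((v b : Matrix.specialUnitaryGroup (Fin N) ℂ) : Matrix (Fin N) (Fin N) ℂ))).re)
            * Real.exp (-(β * (Matrix.trace (1 - ((v b : Matrix.specialUnitaryGroup (Fin N) ℂ) : Matrix (Fin N) (Fin N) ℂ))).re))) := fun v => by
    rw [← Real.exp_add, Finset.prod_congr rfl fun b _ => (Real.exp_add _ _).symm, ← Real.exp_sum]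
    congr 1
    rw [Finset.mul_sum, Finset.mul_sum, ← Finset.sum_neg_distrib, ← Finset.sum_add_distrib]
  have hR : ∀ v : B → Matrix.specialUnitaryGroup (Fin N) ℂ,
      Real.exp (-(β * ∑ b, (Matrix.trace (1 - ((v b : Matrix.specialUnitaryGroup (Fin N) ℂ) : Matrix (Fin N) (Fin N) ℂ))).re))
        = ∏ b, Real.exp (-(β * (Matrix.trace (1 - ((v b : Matrix.specialUnitaryGroup (Fin N) ℂ) : Matrix (Fin N) (Fin N) ℂ))).re)) := fun v => by
    rw [← Real.exp_sum]
    congr 1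
    rw [Finset.mul_sum, ← Finset.sum_neg_distrib]
  set g : Matrix.specialUnitaryGroup (Fin N) ℂ → ℝ := fun V => Real.exp (δ * β * (Matrix.trace (1 - (V : Matrix (Fin N) (Fin N) ℂ))).re) * Real.exp (-(β * (Matrix.trace (1 - (V : Matrix (Fin N) (Fin N) ℂ))).re)) with hg
  set h : Matrix.specialUnitaryGroup (Fin N) ℂ → ℝ := fun V => Real.exp (-(β * (Matrix.trace (1 - (V : Matrix (Fin N) (Fin N) ℂ))).re)) with hh
  have h0 : 0 ≤ ∫ V, g V ∂μ := integral_nonneg fun V => by simp only [hg]; positivity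
  calc ∫ v, Real.exp (δ * β * ∑ b, (Matrix.trace (1 - ((v b : Matrix.specialUnitaryGroup (Fin N) ℂ) : Matrix (Fin N) (Fin N) ℂ))).re)
        * Real.exp (-(β * ∑ b, (Matrix.trace (1 - ((v b : Matrix.specialUnitaryGroup (Fin N) ℂ) : Matrix (Fin N) (Fin N) ℂ))).re)) ∂(Measure.pi fun _ : B => μ)
      = ∫ v, ∏ b, g (v b) ∂(Measure.pi fun _ : B => μ) := integral_congr_ae (ae_of_all _ fun v => hL v)
    _ = (∫ V, g V ∂μ) ^ Fintype.card B := integral_fintype_prod_eq_pow g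
    _ ≤ (K * ∫ V, h V ∂μ) ^ Fintype.card B := pow_le_pow_left₀ h0 hone _
    _ = K ^ Fintype.card B * (∫ V, h V ∂μ) ^ Fintype.card B := mul_pow _ _ _
    _ = K ^ Fintype.card B * ∫ v, ∏ b, h (v b) ∂(Measure.pi fun _ : B => μ) := by rw [integral_fintype_prod_eq_pow h]
    _ = K ^ Fintype.card B * ∫ v, Real.exp (-(β * ∑ b, (Matrix.trace (1 - ((v b : Matrix.specialUnitaryGroup (Fin N) ℂ) : Matrix (Fin N) (Fin N) ℂ))).re)) ∂(Measure.pi fun _ : B => μ) := by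
        rw [integral_congr_ae (ae_of_all _ fun v => hR v)]

/-- **THE `LocCondStability` LETTER OF THE COMPACT-FIBRE REFERENCE STATE, β-FREE AT PRINT's RATE.**  There is `c ≥ 0` (`= log D`, `D` the doubling constant)
such that for EVERY finite bond set `B`, ALL `β ≥ 0` and ALL `0 ≤ δ < 1`, on the product Haar of `B → SU(N)` with `S(v) = Σ_b Re tr(1 − v_b)`:
`∫ e^{δβS}·e^{−βS} dκ ≤ exp(#B·(c + ((N² − 1)∕2)·log(1−δ)⁻¹))·∫ e^{−βS} dκ` — the sacrificed fraction `δ` of the region's Wilson action costs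
`½·dim SU(N)·log(1−δ)⁻¹ + c` per plaquette variable, whatever the coupling. [folklore] -/
theorem exists_lcsLetter_compactFibre : ∃ c : ℝ, 0 ≤ c ∧ ∀ β δ : ℝ, 0 ≤ β → 0 ≤ δ → δ < 1 →
    ∫ v, Real.exp (δ * β * ∑ b, (Matrix.trace (1 - ((v b : Matrix.specialUnitaryGroup (Fin N) ℂ) : Matrix (Fin N) (Fin N) ℂ))).re)
        * Real.exp (-(β * ∑ b, (Matrix.trace (1 - ((v b : Matrix.specialUnitaryGroup (Fin N) ℂ) : Matrix (Fin N) (Fin N) ℂ))).re)) ∂(Measure.pi fun _ : B => haarProbability (Matrix.specialUnitaryGroup (Fin N) ℂ))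
      ≤ Real.exp (Fintype.card B * (c + ((N ^ 2 - 1 : ℕ) : ℝ) / 2 * Real.log (1 - δ)⁻¹))
        * ∫ v, Real.exp (-(β * ∑ b, (Matrix.trace (1 - ((v b : Matrix.specialUnitaryGroup (Fin N) ℂ) : Matrix (Fin N) (Fin N) ℂ))).re)) ∂(Measure.pi fun _ : B => haarProbability (Matrix.specialUnitaryGroup (Fin N) ℂ)) := by
  obtain ⟨D, hD, hone⟩ := exists_halvedAction_moment_le (N := N)
  have hD0 : 0 < D := by linarith
  refine ⟨Real.log D, Real.log_nonneg hD, fun β δ hβ hδ0 hδ1 => ?_⟩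
  set d : ℕ := N ^ 2 - 1 with hd
  have h1δ : 0 < 1 - δ := by linarith
  have hsqrt : 0 < Real.sqrt (1 - δ) := Real.sqrt_pos.2 h1δ
  have hK0 : 0 < D * (Real.sqrt (1 - δ))⁻¹ ^ d := by positivity
  have hpi := pi_halvedAction_moment_le (B := B) (hone β δ hβ hδ0 hδ1)
  -- identify the constant: `(D·(√(1−δ))⁻¹^d)^{#B} = exp(#B·(log D + (d/2)·log(1−δ)⁻¹))`
  have hconst : (D * (Real.sqrt (1 - δ))⁻¹ ^ d) ^ Fintype.card B = Real.exp (Fintype.card B * (Real.log D + (d : ℝ) / 2 * Real.log (1 - δ)⁻¹)) := by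
    rw [← Real.exp_log hK0, ← Real.exp_nat_mul, Real.log_mul hD0.ne' (pow_pos (inv_pos.2 hsqrt) d).ne', Real.log_pow, Real.log_inv,
      Real.log_sqrt h1δ.le, Real.log_inv]
    ring_nf
  rw [hconst] at hpi
  exact hpi

end Region

/-! ## §5 Sanity: `N = 2` -/

section Sanity

/-- For `SU(2)` the factor is `(√(1−δ))⁻¹ ^ 3 = (1−δ)^{−3∕2}` — V26's rate `3∕2 = ½·dim SU(2)`. [folklore] -/
example : ∃ D : ℝ, 1 ≤ D ∧ ∀ β δ : ℝ, 0 ≤ β → 0 ≤ δ → δ < 1 →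
    ∫ V, Real.exp (δ * β * (Matrix.trace (1 - (V : Matrix (Fin 2) (Fin 2) ℂ))).re) * Real.exp (-(β * (Matrix.trace (1 - (V : Matrix (Fin 2) (Fin 2) ℂ))).re)) ∂(haarProbability (Matrix.specialUnitaryGroup (Fin 2) ℂ))
      ≤ D * (Real.sqrt (1 - δ))⁻¹ ^ 3 * ∫ V, Real.exp (-(β * (Matrix.trace (1 - (V : Matrix (Fin 2) (Fin 2) ℂ))).re)) ∂(haarProbability (Matrix.specialUnitaryGroup (Fin 2) ℂ)) :=
  exists_halvedAction_moment_le (N := 2)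

end Sanity

end Summit.QuantumFields.BalabanUV.T4Continuum.NE7b.CompactFibreHalvedActionSUN

end
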